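import Summits.Ventures.Crystal3D.Theorems.StickyWulffConstantCoaxialWallLawSeamStarTwelveReading
import HarnessLib

/-!
# FULL-reader ends: every SATURATED common neighbour of the end ball and its reader is FULL or TWIN-READING (E1) — the row datum of `SatCensus11Full`
# (crux `CoaxialWallLaw`, stmt-Ventures-19481; lane F 'Certificates' v8.3R, registered stub `stub_threePayer`, piece `SatCensus11Full`)

HONEST FRAMING. Venture `Summits/Ventures/Crystal3D` (cell `crystal3d-full`); sequel of '…SeamStarTwelveReading'.  CONDITIONAL on `P5Exhaustion`.  At a FULL-reader end
`b = q + G u` (`q` FULL in `G`), a member `y = q + G t` of the reader's dozen carries the CLOSED `G`-star of `−t` (the reader and its four slot balls adjacent to `y`, all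
present because `q` is FULL).  Hence (E1, '…SeamStarTwelveReading') a SATURATED such `y` is `G`-FULL or TWIN-READING with that star on the own side.  Applied to the four
common neighbours `nₛ = b + G s = q + G(u + s)` (`⟪s, −u⟫ = ½`) this is exactly the per-row datum of seat g14's 85-row table (memo F-TAIL-g14 §5, HOME/wall-19481-p2/g14-calc/
fullreader_enum.py): FULL ⇒ all `nₛ + G w` present; TWIN `n` ⇒ own slots present, far slots ABSENT, mirrors present (`slot_occupied_iff_of_twinReading`).
* `star_occupied_of_full_member`, **`isFull_or_isTwinReading_of_full_member`**, **`isFull_or_isTwinReading_coNbr`** (the common-neighbour form, `nₛ = b + G s`).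
WHAT THIS IS NOT: the row table itself is not typed here; F-C1 not moved.
-/

noncomputable section

namespace Summit.Ventures.Crystal3D.Theorems

namespace TailResidue

open Summit.Ventures.Crystal3D Finset
open scoped InnerProductSpace

variable {X : Finset (EuclideanSpace ℝ (Fin 3))}

/-- **A member of a FULL dozen carries a closed star pointing to the centre.**  `q` FULL in `G`, `t` a slot, `y = q + G t`: every `y + G w` with `⟪w, −t⟫ > 0` is present. -/
theorem star_occupied_of_full_member (G : EuclideanSpace ℝ (Fin 3) ≃ₗᵢ[ℝ] EuclideanSpace ℝ (Fin 3)) {q y t : EuclideanSpace ℝ (Fin 3)} (hq : q ∈ X) (ht : t ∈ fccSlots)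
    (hfull : IsFull X G q) (hy : y = q + G t) : ∀ w ∈ fccSlots, 0 < ⟪w, -t⟫_ℝ → y + G w ∈ X := by
  intro w hw hpos
  rcases eq_or_inner_eq_half_of_inner_pos hw (neg_mem_fccSlots ht) hpos with h | h
  · rw [h, hy, map_neg, add_neg_cancel_right]; exact hq
  · -- `w + t` is a slot (`⟪w, t⟫ = −½`) and `y + G w = q + G (t + w)`
    have hwt : ⟪w, t⟫_ℝ = -(1 / 2) := by rw [inner_neg_right] at h; linarith
    have hs : w - -t ∈ fccSlots := sub_mem_fccSlots_of_inner_eq_half hw (neg_mem_fccSlots ht) h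
    rw [sub_neg_eq_add] at hs
    have e : y + G w = q + G (w + t) := by rw [hy, map_add]; abel
    rw [e]; exact hfull _ hs

open scoped Classical in
/-- **A SATURATED member of a FULL dozen is FULL or TWIN-READING (E1)**, with the star of `−t` on the own side. -/
theorem isFull_or_isTwinReading_of_full_member (hE1 : P5Exhaustion) (hX : ∀ p ∈ X, ∀ p' ∈ X, p ≠ p' → 1 ≤ dist p p')
    (G : EuclideanSpace ℝ (Fin 3) ≃ₗᵢ[ℝ] EuclideanSpace ℝ (Fin 3)) {q y t : EuclideanSpace ℝ (Fin 3)} (hq : q ∈ X) (ht : t ∈ fccSlots) (hfull : IsFull X G q)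
    (hy : y = q + G t) (h12 : (X.filter fun c => dist y c = 1).card = 12) :
    IsFull X G y ∨ ∃ n, IsTwinReading X G n y ∧ ∀ w ∈ fccSlots, 0 < ⟪w, -t⟫_ℝ → ⟪G w, n⟫_ℝ ≤ 0 :=
  isFull_or_isTwinReading_of_star_twelve hE1 hX G (neg_mem_fccSlots ht) (star_occupied_of_full_member G hq ht hfull hy) h12

open scoped Classical in
/-- **COMMON-NEIGHBOUR FORM.**  At a FULL-reader end `b = q + G u`, a saturated common neighbour `nₛ = b + G s` (`s` a slot with `⟪s, −u⟫ = ½`) is `G`-FULL or TWIN-READING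
with the star of `−(u + s)` (pointing to `q`) on the own side. -/
theorem isFull_or_isTwinReading_coNbr (hE1 : P5Exhaustion) (hX : ∀ p ∈ X, ∀ p' ∈ X, p ≠ p' → 1 ≤ dist p p')
    (G : EuclideanSpace ℝ (Fin 3) ≃ₗᵢ[ℝ] EuclideanSpace ℝ (Fin 3)) {q b u s : EuclideanSpace ℝ (Fin 3)} (hq : q ∈ X) (hu : u ∈ fccSlots) (hs : s ∈ fccSlots)
    (hsu : ⟪s, -u⟫_ℝ = 1 / 2) (hfull : IsFull X G q) (hbq : b = q + G u) (h12 : (X.filter fun c => dist (b + G s) c = 1).card = 12) :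
    IsFull X G (b + G s) ∨ ∃ n, IsTwinReading X G n (b + G s) ∧ ∀ w ∈ fccSlots, 0 < ⟪w, -(u + s)⟫_ℝ → ⟪G w, n⟫_ℝ ≤ 0 := by
  have hus : u + s ∈ fccSlots := by
    have h' : ⟪u, -s⟫_ℝ = 1 / 2 := by rw [inner_neg_right, real_inner_comm]; rw [inner_neg_right] at hsu; linarith
    have := sub_mem_fccSlots_of_inner_eq_half hu (neg_mem_fccSlots hs) h'
    rwa [sub_neg_eq_add] at this
  have hy : b + G s = q + G (u + s) := by rw [hbq, map_add, add_assoc]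
  exact isFull_or_isTwinReading_of_full_member hE1 hX G hq hus hfull hy h12

end TailResidue

end Summit.Ventures.Crystal3D.Theorems

end
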